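import Summits.BirchSwinnertonDyer.Rank1Residual.AdditivePotMult.PotMultRankZeroUpperHalfOfExactLeadingTerm
import Summits.BirchSwinnertonDyer.Rank1Residual.AdditivePotMult.PotMultRankZeroUpperHalfOfProp414
import Summits.BirchSwinnertonDyer.Rank1Residual.Additive.PalTwistPeriodHolds
import HarnessLib

/-!
# X4(M), rank `0`, EVERY odd `p`: the UPPER half and the class ENDs with Delbourgo 1998 Prop. 4 SUPPLIED
# AT THE PAIR by its exact (M) reading (A181) and the Pal period fact FED by its tree proof — `hDel`,
# `hPal` OUT, nothing added (cell `b2b-bsdres`, team n1011, ROW T-DEL98X, seat p10 GEN 10, FILE 3 —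
# the `p ≥ 5` (N10-strand) twin of FILE 1)

HONEST FRAMING (cell `b2b-bsdres`, run/shared/lean/b2b/bsd-rank1-residual/, verbatim in every
file): the goal of the cell is to DELETE the COMBINATION-SHAPED residual classes of the
Birch–Swinnerton-Dyer formula for ALL analytic-rank `≤ 1` elliptic curves over `ℚ` — "full BSD
formula for every rank `≤ 1` curve in class `C`" assembled STRICTLY from published theorems — so
that the rank-`≤ 1` remainder becomes exactly the CONSTRUCTION-SHAPED classes, which are TYPED
(missing-input `Prop`s), NOT attempted. This is not "finishing BSD". Team n1011 (N10 / N11): research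
route; TOOL + END-twin theorems only — no definition, no named fact, no `sorry`; nothing booked; no
residual-map mark / label / count moved; X4(M) stays CONSTRUCTION-SHAPED. NOTHING of additive-p4's /
p06's / p07's is edited: every declaration below is NEW and consumes theirs BY NAME.

## What and why

FILE 1 (`PotMultRankZeroUpperHalfOfExactLeadingTerm`) did `p = 3` (the N11 (M) rows). At `p ≥ 5` (the
N10 (M) rows; route 2's `13 @ ≥ 5` include 10 (M) rows) the same surgery applies: the UPPER half reads
A75 only through p06's `hdivAt`, which A181 supplies at every (M) pair (FILE 1 §1, every odd `p`); the
LOWER half of the class ENDs reads A181 and, on the even branch `p ≡ 1 (mod 4)`, Pal 2012 Thm. 3.2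
(`hPal`, A76) — a THEOREM of the tree (additive-p4's
`pal2012_thm32_sqrt_mul_realPeriodRat_twist_eq_of_prime_one_mod_four_holds`,
`Additive/PalTwistPeriodHolds.lean`), fed here by name.

* §1 `X4RankZeroTwistEven.missingUpperBoundAt_of_surj_of_shaDvd` (`p ≡ 1 (mod 4)`, over p06's even core
  `AdditiveTwistEven.missingUpperBoundAt_of_leadingTerm_of_shaDvd` BY NAME) and
  `X4RankZeroTwistOdd.missingUpperBoundAt_of_surj_of_shaDvd` (`p ≡ 3 (mod 4)`, `p ≠ 3`: Serre lifts
  `surj(p)` to the tower of `E♭`; over FILE 1 §2) — additive-p4's `…_of_surj` twist-level theorems with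
  `hDel ↦ hdivAt` (p06's FILE 3b has only the Prop-4.14-specialised forms).
* §2 `ClassX4M.missingUpperBoundAt_rankZero_of_chiBranch_of_surj_of_ne_three_of_shaDvd` and
  `ClassX4M.missingUpperBoundAt_rankZero_of_surj_of_exactLeadingTerm` — X4(M) ∧ `r_an = 0` ∧ surj(p),
  ANY odd `p`: the UPPER half from {A181 `hDelX`, GZK, `hmod`, `hmodD`, A136 `hKato`} (`p = 3` by FILE 1
  §3, `p ≠ 3` by §1; the tree's `ClassX4M.missingUpperBoundAt_rankZero_of_surj_noL20` with
  `{hDel} ↦ {hDelX}`).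
* §3 ENDs, ANY odd `p`: `ClassX4M.bsdp_rankZero_of_surj_of_lower_of_exactLeadingTerm`,
  `…_of_shaAn_unit_of_exactLeadingTerm`, `ClassX4M.missingInputAt_iff_lower_rankZero_of_surj_of_exactLeadingTerm`,
  and the END TWINS with binder diff EXACTLY {`hDel`, `hPal`} ↦ ∅, NOTHING added, conclusion and row
  universe identical: `ClassX4M.bsdp_rankZero_of_surj_of_quadraticBranchLower_exact` (additive-p4's
  `…_of_quadraticBranchLower`: 7 ↦ 5) and
  `ClassX4M.bsdp_rankZero_of_surj_of_katoHalf_of_firstUnitIndex_of_budget_exact` (p07's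
  `…_of_firstUnitIndex_of_budget`, both parities: 7 ↦ 5 = {hK, hDelX, hGZK, hmod, hmodD}) and its
  Ш-door form `…_of_firstUnitIndex_of_pow_le_card_selmerGroup_exact` (+ h414; route 2's ledger shape at
  `p ≥ 5`, r2 GEN 43 08:25Z).

What is NOT claimed: no row is closed; nothing is booked; the X3♯(M) twins are not in this file. Axioms
standard.

References: [Delbourgo1998] Thm. 3 (p. 143), Prop. 4 (p. 144), §2.2 Lemma (ii) (p. 139);
[Kato2004Asterisque] Thm. 17.4 (3) (p. 273); [Wuthrich2014] Thm. 4, Cor. 19; [Pal2012] Thm. 3.2;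
[SerreAbelianLadic1968] IV §3.4 Lemma 3; [Miller2011LMS] Def. 1.1; cells/n1011/PLAN.md §K.2;
names line cells/n1011/INBOX.md 2026-08-22T07:53Z; lead R5-106 (t).
-/

noncomputable section

open scoped Classical MatrixGroups ModularForm NumberField

open CongruenceSubgroup WeierstrassCurve NumberField Literature.NumberTheory.EllipticCurves
  Literature.NumberTheory.EllipticCurves.ModularForms
  Literature.NumberTheory.EllipticCurves.Rank1Residual
  Literature.NumberTheory.EllipticCurves.Rank1Residual.Typed
  IsDedekindDomain Rat.HeightOneSpectrum

/-! ### §1 X4, both parities, `p ≠ 3`: additive-p4's `…_of_surj` twist levels on the abstract supplier -/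

namespace Summit.BirchSwinnertonDyer.Rank1Residual.Additive

section Twist

variable (W : WeierstrassCurve ℚ) [W.IsElliptic] [W.IsGloballyMinimal] (p : ℕ) [hp : Fact p.Prime]

/-- **Even branch (`p ≡ 1 (mod 4)`), image hypothesis `surj(p)` of `E`, on the ABSTRACT supplier:
`Typed.MissingUpperBoundAt W p`** on X4 ∧ `r_an = 0` ∧ (semistable twist `W = C • V^{(p)}`, `V` good
ordinary or multiplicative at `p`), granted `ChiBranchLeadingTermBigImageAt W p` — additive-p4's
`X4RankZeroTwistEven.missingUpperBoundAt_of_surj` with `hDel ↦ hdivAt`, over p06's even core BY NAME.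
[cite: Kato2004Asterisque, Thm. 17.4 (3) (p. 273)] [cite: Delbourgo1998, Prop. 4 (p. 144) (shape of the abstracted input only)]
[cite: Miller2011LMS, Def. 1.1] -/
theorem X4RankZeroTwistEven.missingUpperBoundAt_of_surj_of_shaDvd
    (hdivAt : ∀ (κ : ZpExtension ℚ p) (γ : Field.absoluteGaloisGroup ℚ), κ.IsCyclotomic →
      κ.IsTopGenerator γ → ∀ D : W.SelmerDualData κ γ, Finite W.sha → Finite W.toAffine.Point →
      ∀ g ∈ D.charIdeal,
        (p : ℤ_[p]) ^ (padicValNat p (Nat.card (AddCommGroup.primaryComponent W.sha p)) +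
            padicValNat p (∏ᶠ v : HeightOneSpectrum (𝓞 ℚ),
              if (p : 𝓞 ℚ) ∈ v.asIdeal then 1 else W.tamagawaNumberAt v)) ∣
          PowerSeries.constantCoeff g * ((Nat.card W.toAffine.Point : ℕ) : ℤ_[p]) ^ 2)
    (hGZK : rank_eq_analyticRank_of_analyticRank_le_one) (hmod : hasEntireLFunction_rat)
    (hBC : ChiBranchLeadingTermBigImageAt W p)
    (hp4 : p % 4 = 1) (hr : W.analyticRank = 0) (hX : ClassX4 W p) (hsurj : Surj W p)
    (V : WeierstrassCurve ℚ) [V.IsElliptic] [V.IsGloballyMinimal]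
    (C : VariableChange ℚ) (hC : C • V.quadraticTwist (p : ℚ) = W) (hV : GoodOrd V p ∨ Mult V p)
    {N : ℕ} [NeZero N] {f : CuspForm (Gamma0 N) 2} (hf : IsNewformOf V f)
    (ϖ : ℚ) (hϖ : (ϖ : ℝ) * V.realPeriodRat = plusPeriod f) :
    MissingUpperBoundAt W p :=
  AdditiveTwistEven.missingUpperBoundAt_of_leadingTerm_of_shaDvd W p hdivAt hGZK hmod hp4 hr hX.2.1 V C
    hC hV hf ϖ hϖ
    fun _ _ hκ hγ hγ' D ↦ (hBC V hp4 ⟨C, hC⟩ hV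
      (X4RankZeroTwistEven.forall_surj_pow_twist_of_surj W p hp4 V C hC hsurj) hκ hγ hγ' hf D ϖ hϖ).2

omit [W.IsElliptic] [W.IsGloballyMinimal] in
/-- `p ≡ 3 (mod 4)` and `p ≠ 3` give `p ≥ 5`. [folklore] -/
private theorem five_le_of_mod_four_eq_three_of_ne_three'' (hp4 : p % 4 = 3) (hp3 : p ≠ 3) :
    5 ≤ p := by
  have h2 := hp.out.two_le
  by_contra h
  interval_cases p <;> simp_all

/-- **Odd branch (`p ≡ 3 (mod 4)`, `p ≠ 3`), image hypothesis `surj(p)` of `E`, on the ABSTRACT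
supplier: `Typed.MissingUpperBoundAt W p`** (Serre lifts `surj(p)` to `ρ̄_{V,pⁿ}` onto, `p ≥ 7`;
`c_p(E)` a `p`-unit on a `±p`-twist) — additive-p4's `X4RankZeroTwistOdd.missingUpperBoundAt_of_surj`
with `hDel ↦ hdivAt`, over FILE 1 §2. [cite: SerreAbelianLadic1968, Ch. IV §3.4, Lemma 3]
[cite: Kato2004Asterisque, Thm. 17.4 (3) (p. 273)] [cite: Delbourgo1998, Prop. 4 (p. 144) (shape of the abstracted input only)] -/
theorem X4RankZeroTwistOdd.missingUpperBoundAt_of_surj_of_shaDvd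
    (hdivAt : ∀ (κ : ZpExtension ℚ p) (γ : Field.absoluteGaloisGroup ℚ), κ.IsCyclotomic →
      κ.IsTopGenerator γ → ∀ D : W.SelmerDualData κ γ, Finite W.sha → Finite W.toAffine.Point →
      ∀ g ∈ D.charIdeal,
        (p : ℤ_[p]) ^ (padicValNat p (Nat.card (AddCommGroup.primaryComponent W.sha p)) +
            padicValNat p (∏ᶠ v : HeightOneSpectrum (𝓞 ℚ),
              if (p : 𝓞 ℚ) ∈ v.asIdeal then 1 else W.tamagawaNumberAt v)) ∣
          PowerSeries.constantCoeff g * ((Nat.card W.toAffine.Point : ℕ) : ℤ_[p]) ^ 2)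
    (hGZK : rank_eq_analyticRank_of_analyticRank_le_one) (hmod : hasEntireLFunction_rat)
    (hBC : ChiBranchLeadingTermOddBigImageAt W p)
    (hp4 : p % 4 = 3) (hp3 : p ≠ 3) (hr : W.analyticRank = 0) (hX : ClassX4 W p) (hsurj : Surj W p)
    (V : WeierstrassCurve ℚ) [V.IsElliptic] [V.IsGloballyMinimal]
    (C : VariableChange ℚ) (hC : C • V.quadraticTwist (-(p : ℚ)) = W) (hV : GoodOrd V p ∨ Mult V p)
    {N : ℕ} [NeZero N] {f : CuspForm (Gamma0 N) 2} (hf : IsNewformOf V f)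
    (ϖ : ℚ) (hϖ : (ϖ : ℝ) * V.imaginaryPeriodRat = minusPeriod f) :
    MissingUpperBoundAt W p :=
  have hp2 : p ≠ 2 := by omega
  X4RankZeroTwistOdd.missingUpperBoundAt_of_shaDvd W p hdivAt hGZK hmod hBC hp4 hr hX V C hC hV
    (X4RankZeroTwistOdd.forall_surj_pow_twist_of_surj W p
      (five_le_of_mod_four_eq_three_of_ne_three'' p hp4 hp3) V
      (neg_ne_zero.mpr (Nat.cast_ne_zero.mpr hp.out.ne_zero)) C hC hsurj) hf ϖ hϖ
    (not_dvd_tamagawaNumberAt_twist_pm_p p hp2 V (hV.elim (fun h ↦ Or.inl h.1) Or.inr)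
      (d := -(p : ℚ)) (Or.inr rfl) C hC)

end Twist

end Summit.BirchSwinnertonDyer.Rank1Residual.Additive

/-! ### §2 X4(M) ∧ `r_an = 0` ∧ surj(p), ANY odd `p`: the UPPER half on the abstract supplier / on A181 -/

namespace Summit.BirchSwinnertonDyer.Rank1Residual.AdditivePotMult

open Additive Additive.CensusQ6

variable {W : WeierstrassCurve ℚ} [W.IsElliptic] [W.IsGloballyMinimal] {p : ℕ} [hp : Fact p.Prime]

/-- **X4(M) ∧ `r_an = 0` ∧ surj(p), `p ≠ 3`, on the ABSTRACT supplier: `Typed.MissingUpperBoundAt W p`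
from the typed `χ_p`-branch inputs** — additive-p4's `ClassX4M.missingUpperBoundAt_rankZero_of_chiBranch`
(`V` = minimal model of `E^{(p*)}`, multiplicative at `p`; newform / period ratios from `hmodD`) with
`hDel ↦ hdivAt` and its `p = 3 → ram` premise made vacuous by `p ≠ 3`.
[cite: Kato2004Asterisque, Thm. 17.4 (3) (p. 273)] [cite: EdixhovenManin1991, §1]
[cite: Delbourgo1998, Prop. 4 (p. 144) (shape of the abstracted input only)] -/
theorem ClassX4M.missingUpperBoundAt_rankZero_of_chiBranch_of_surj_of_ne_three_of_shaDvd
    (hdivAt : ∀ (κ : ZpExtension ℚ p) (γ : Field.absoluteGaloisGroup ℚ), κ.IsCyclotomic →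
      κ.IsTopGenerator γ → ∀ D : W.SelmerDualData κ γ, Finite W.sha → Finite W.toAffine.Point →
      ∀ g ∈ D.charIdeal,
        (p : ℤ_[p]) ^ (padicValNat p (Nat.card (AddCommGroup.primaryComponent W.sha p)) +
            padicValNat p (∏ᶠ v : HeightOneSpectrum (𝓞 ℚ),
              if (p : 𝓞 ℚ) ∈ v.asIdeal then 1 else W.tamagawaNumberAt v)) ∣
          PowerSeries.constantCoeff g * ((Nat.card W.toAffine.Point : ℕ) : ℤ_[p]) ^ 2)
    (hGZK : rank_eq_analyticRank_of_analyticRank_le_one) (hmod : hasEntireLFunction_rat)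
    (hmodD : nonempty_modularParametrizationData)
    (hBCeven : ChiBranchLeadingTermBigImageAt W p) (hBCodd : ChiBranchLeadingTermOddBigImageAt W p)
    (hX : ClassX4M W p) (hr : W.analyticRank = 0) (hsurj : Surj W p) (hp3 : p ≠ 3) :
    MissingUpperBoundAt W p := by
  obtain ⟨V, iV, iVm, C, hV, hC⟩ := hX.exists_mult_pStar_twist_model
  haveI : NeZero (V.conductorNorm ℤ) := ⟨(V.conductorNorm_pos_holds).ne'⟩
  obtain ⟨Dm⟩ := hmodD V
  obtain ⟨ϖ, -, hϖ, -⟩ := Dm.exists_rat_mul_realPeriodRat_eq_plusPeriod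
  obtain ⟨ϖ', -, hϖ'⟩ := exists_rat_mul_imaginaryPeriodRat_eq_minusPeriod Dm
  have hodd : p % 4 = 1 ∨ p % 4 = 3 := by
    obtain ⟨k, hk⟩ := hp.out.odd_of_ne_two hX.p_ne_two
    omega
  rcases hodd with h1 | h3
  · have hC' : C • V.quadraticTwist (p : ℚ) = W := by
      rw [pStar_eq_of_mod_four p (Or.inl h1), if_pos h1] at hC
      exact hC
    exact X4RankZeroTwistEven.missingUpperBoundAt_of_surj_of_shaDvd W p hdivAt hGZK hmod hBCeven h1 hr
      hX.1 hsurj V C hC' (Or.inr hV) Dm.isNewformOf ϖ hϖ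
  · have hC' : C • V.quadraticTwist (-(p : ℚ)) = W := by
      rw [pStar_eq_of_mod_four p (Or.inr h3), if_neg (by omega)] at hC
      exact hC
    exact X4RankZeroTwistOdd.missingUpperBoundAt_of_surj_of_shaDvd W p hdivAt hGZK hmod hBCodd h3 hp3 hr
      hX.1 hsurj V C hC' (Or.inr hV) Dm.isNewformOf ϖ' hϖ'

/-- **X4(M) ∧ `r_an(E) = 0` ∧ surj(p), ANY odd `p` (`p = 3` included): the UPPER half
`ord_p #Ш(E) ≤ ord_p #Ш_an(E)` from {A181 `hDelX`, GZK, modularity `hmod` `hmodD`, Kato's half-eigen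
divisibility A136 `hKato`}** — the tree's `ClassX4M.missingUpperBoundAt_rankZero_of_surj_noL20` with the
binder surgery `{hDel} ↦ {hDelX}` (`p = 3`: FILE 1 §3; `p ≠ 3`: §2 here, the branch inputs discharged by
`PotMult.chiBranchLeadingTerm[Odd]BigImageAt_of_halfFact`). NO `ram`, NO Tamagawa, NO Manin, NO `hL20`
binder. X4(M) stays CONSTRUCTION-SHAPED; nothing booked.
[cite: Delbourgo1998, Prop. 4 (p. 144) and §2.2 Lemma (ii) (p. 139)] [cite: Kato2004Asterisque, Thm. 17.4 (3) (p. 273)]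
[cite: Wuthrich2014, Thm. 4 (p. 383), Cor. 19 (p. 398)] -/
theorem ClassX4M.missingUpperBoundAt_rankZero_of_surj_of_exactLeadingTerm
    (hDelX : Delbourgo1998.prop4_rankZero_constantCoeff_eq_unit_mul_of_potMult)
    (hGZK : rank_eq_analyticRank_of_analyticRank_le_one) (hmod : hasEntireLFunction_rat)
    (hmodD : nonempty_modularParametrizationData)
    (hKato : Wuthrich2014.kato_halfEigenCharIdeal_dvd_cyclotomicPrime_of_surjective)
    (hX : ClassX4M W p) (hr : W.analyticRank = 0) (hsurj : Surj W p) : MissingUpperBoundAt W p := by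
  by_cases hp3 : p = 3
  · subst hp3
    exact ClassX4M.missingUpperBoundAt_three_rankZero_of_surj_of_exactLeadingTerm hDelX hGZK hmod hmodD
      hKato hX hr hsurj
  · exact ClassX4M.missingUpperBoundAt_rankZero_of_chiBranch_of_surj_of_ne_three_of_shaDvd
      ((ClassX4M.potMult W p hX).shaDvdAt_of_exactLeadingTerm hDelX hX.p_ne_two hr) hGZK hmod hmodD
      ((ClassX4M.potMult W p hX).chiBranchLeadingTermBigImageAt_of_halfFact hKato)
      ((ClassX4M.potMult W p hX).chiBranchLeadingTermOddBigImageAt_of_halfFact hKato) hX hr hsurj hp3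

/-! ### §3 The class ENDs, ANY odd `p`, with `hDel` and `hPal` OUT, nothing added -/

/-- **X4(M) ∧ `r_an(E) = 0` ∧ surj(p), ANY odd `p`: `BSD(E,p)` from the LOWER half** — the tree's
`ClassX4M.bsdp_rankZero_of_surj_of_lower_noL20` with `{hDel} ↦ {hDelX}`.
[cite: Delbourgo1998, Prop. 4 (p. 144) and §2.2 Lemma (ii) (p. 139)] [cite: Kato2004Asterisque, Thm. 17.4 (3) (p. 273)]
[cite: Miller2011LMS, §1 and Def. 1.1] -/
theorem ClassX4M.bsdp_rankZero_of_surj_of_lower_of_exactLeadingTerm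
    (hDelX : Delbourgo1998.prop4_rankZero_constantCoeff_eq_unit_mul_of_potMult)
    (hGZK : rank_eq_analyticRank_of_analyticRank_le_one) (hmod : hasEntireLFunction_rat)
    (hmodD : nonempty_modularParametrizationData)
    (hKato : Wuthrich2014.kato_halfEigenCharIdeal_dvd_cyclotomicPrime_of_surjective)
    (hX : ClassX4M W p) (hr : W.analyticRank = 0) (hsurj : Surj W p)
    (hlow : MissingLowerBoundAt W p) : BSDp W p :=
  bsdp_of_missingPPartAt W p hGZK (by rw [hr]; exact zero_le_one)
    (missingPPartAt_of_lower_of_upper W p hlow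
      (ClassX4M.missingUpperBoundAt_rankZero_of_surj_of_exactLeadingTerm hDelX hGZK hmod hmodD hKato hX hr
        hsurj))

/-- **X4(M) ∧ `r_an(E) = 0` ∧ surj(p) ∧ `p ∤ #Ш_an(E)`, ANY odd `p`: `BSD(E,p)`** — `{hDel} ↦ {hDelX}`
form of the tree's `ClassX4M.bsdp_rankZero_of_surj_of_shaAn_unit_noL20`.
[cite: Delbourgo1998, Prop. 4 (p. 144) and §2.2 Lemma (ii) (p. 139)] [cite: Kato2004Asterisque, Thm. 17.4 (3) (p. 273)]
[cite: Miller2011LMS, §1 and Def. 1.1] -/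
theorem ClassX4M.bsdp_rankZero_of_surj_of_shaAn_unit_of_exactLeadingTerm
    (hDelX : Delbourgo1998.prop4_rankZero_constantCoeff_eq_unit_mul_of_potMult)
    (hGZK : rank_eq_analyticRank_of_analyticRank_le_one) (hmod : hasEntireLFunction_rat)
    (hmodD : nonempty_modularParametrizationData)
    (hKato : Wuthrich2014.kato_halfEigenCharIdeal_dvd_cyclotomicPrime_of_surjective)
    (hX : ClassX4M W p) (hr : W.analyticRank = 0) (hsurj : Surj W p)
    {q : ℚ} (hq : shaAn W = (q : ℂ)) (hv : padicValRat p q = 0) : BSDp W p :=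
  bsdp_of_missingPPartAt W p hGZK (by rw [hr]; exact zero_le_one)
    (missingPPartAt_of_upper_of_shaAn_unit W p
      (ClassX4M.missingUpperBoundAt_rankZero_of_surj_of_exactLeadingTerm hDelX hGZK hmod hmodD hKato hX hr
        hsurj) hq hv)

/-- **X4(M) ∧ `r_an(E) = 0` ∧ surj(p), ANY odd `p`: what remains of X4♯ at the pair is EXACTLY the
lower half** (`Typed.X4.MissingInputAt W p ↔ MissingLowerBoundAt W p`), `{hDel} ↦ {hDelX}` form.
[cite: Delbourgo1998, Prop. 4 (p. 144) and §2.2 Lemma (ii) (p. 139)] [cite: Kato2004Asterisque, Thm. 17.4 (3) (p. 273)] -/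
theorem ClassX4M.missingInputAt_iff_lower_rankZero_of_surj_of_exactLeadingTerm
    (hDelX : Delbourgo1998.prop4_rankZero_constantCoeff_eq_unit_mul_of_potMult)
    (hGZK : rank_eq_analyticRank_of_analyticRank_le_one) (hmod : hasEntireLFunction_rat)
    (hmodD : nonempty_modularParametrizationData)
    (hKato : Wuthrich2014.kato_halfEigenCharIdeal_dvd_cyclotomicPrime_of_surjective)
    (hX : ClassX4M W p) (hr : W.analyticRank = 0) (hsurj : Surj W p) :
    X4.MissingInputAt W p ↔ MissingLowerBoundAt W p :=
  ⟨fun h ↦ (lower_and_upper_of_missingPPartAt W p h).1, fun h ↦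
    missingPPartAt_of_lower_of_upper W p h
      (ClassX4M.missingUpperBoundAt_rankZero_of_surj_of_exactLeadingTerm hDelX hGZK hmod hmodD hKato hX hr
        hsurj)⟩

/-- **END TWIN — X4(M) ∧ surj(p) ∧ `r_an = 0`, ANY odd `p`: `BSD(E,p)` ⟸ OUR `E♭`-level conjecture**,
additive-p4's `ClassX4M.bsdp_rankZero_of_surj_of_quadraticBranchLower` with binder diff EXACTLY
{`hDel`, `hPal`} ↦ ∅, NOTHING added (named facts 7 ↦ 5 = {hDelX, hGZK, hmod, hmodD, hKato}; conclusion
identical; `hPal` fed by its tree proof `pal2012_…_holds`).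
[cite: Delbourgo1998, Prop. 4 (p. 144), §2.2 Lemma (ii) (p. 139), Main Conjecture (p. 151) (shape)]
[cite: Pal2012, Thm. 3.2] [cite: Kato2004Asterisque, Thm. 17.4 (3) (p. 273)] [cite: Miller2011LMS, §1 and Def. 1.1] -/
theorem ClassX4M.bsdp_rankZero_of_surj_of_quadraticBranchLower_exact
    (hDelX : Delbourgo1998.prop4_rankZero_constantCoeff_eq_unit_mul_of_potMult)
    (hGZK : rank_eq_analyticRank_of_analyticRank_le_one) (hmod : hasEntireLFunction_rat)
    (hmodD : nonempty_modularParametrizationData)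
    (hKato : Wuthrich2014.kato_halfEigenCharIdeal_dvd_cyclotomicPrime_of_surjective)
    (hX : ClassX4M W p) (hr : W.analyticRank = 0) (hsurj : Surj W p)
    (hc : ∀ (V : WeierstrassCurve ℚ) [V.IsElliptic] [V.IsGloballyMinimal],
      (∃ C : VariableChange ℚ, C • V.quadraticTwist ((-1) ^ (p / 2) * p : ℚ) = W) →
        QuadraticBranchLowerDivisibilityAt V p) :
    BSDp W p :=
  ClassX4M.bsdp_rankZero_of_surj_of_lower_of_exactLeadingTerm hDelX hGZK hmod hmodD hKato hX hr hsurj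
    (ClassX4M.missingLowerBoundAt_rankZero_of_quadraticBranchLower hDelX
      pal2012_thm32_sqrt_mul_realPeriodRat_twist_eq_of_prime_one_mod_four_holds hGZK hmod hmodD hX hr hc)

/-- **END TWIN — X4(M) ∧ surj(p) ∧ `r_an = 0`, ANY odd `p`: `BSD(E,p)` ⟸ the census record of the
parity of `(p−1)/2` at index `b` + the budget `BudgetLeLambdaAt p E b`**, n1011-p07's
`ClassX4M.bsdp_rankZero_of_surj_of_katoHalf_of_firstUnitIndex_of_budget` with binder diff EXACTLY
{`hDel`, `hPal`} ↦ ∅, NOTHING added (named facts 7 ↦ 5 = {hK, hDelX, hGZK, hmod, hmodD}; conclusion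
identical; p07's lower half consumed BY NAME with `hPal` fed by its tree proof). PER PAIR; EVIDENCE-tier
inputs; X4(M) stays CONSTRUCTION-SHAPED; nothing booked.
[cite: Kato2004Asterisque, Thm. 17.4 (3) (p. 273)] [cite: Delbourgo1998, Prop. 4 (p. 144) and §2.2 Lemma (ii) (p. 139)]
[cite: Pal2012, Thm. 3.2] [cite: EmertonPollackWeston2006, Cor. 3.2.5 and Thm. 3.1.1 (source of the typed input)]
[cite: Miller2011LMS, §1 and Def. 1.1] -/
theorem ClassX4M.bsdp_rankZero_of_surj_of_katoHalf_of_firstUnitIndex_of_budget_exact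
    (hK : Wuthrich2014.kato_halfEigenCharIdeal_dvd_cyclotomicPrime_of_surjective)
    (hDelX : Delbourgo1998.prop4_rankZero_constantCoeff_eq_unit_mul_of_potMult)
    (hGZK : rank_eq_analyticRank_of_analyticRank_le_one) (hmod : hasEntireLFunction_rat)
    (hmodD : nonempty_modularParametrizationData)
    (hX : ClassX4M W p) (hsurj : Surj W p) (hr : W.analyticRank = 0) {b : ℕ}
    (hrec : (p % 4 = 1 → MultFirstUnitIndexAt W p b) ∧ (p % 4 = 3 → MultOddFirstUnitIndexAt W p b))
    (hbud : BudgetLeLambdaAt p W b) : BSDp W p :=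
  ClassX4M.bsdp_rankZero_of_surj_of_lower_of_exactLeadingTerm hDelX hGZK hmod hmodD hK hX hr hsurj
    (ClassX4M.missingLowerBoundAt_rankZero_of_katoHalf_of_firstUnitIndex_of_budget hK hDelX
      pal2012_thm32_sqrt_mul_realPeriodRat_twist_eq_of_prime_one_mod_four_holds hGZK hmod hmodD hX hsurj
      hr hrec hbud)

/-- **END TWIN — ROUTE 2's (M) ledger at `p ≥ 5` (ARM σ, general `p`): X4(M) ∧ surj(p) ∧ `r_an = 0`,
ANY odd `p`: `BSD(E,p)` ⟸ the record of the parity of `(p−1)/2` at index `b` + `p ^ b ≤ #Sel⁽ᵖ⁾(E/ℚ)`**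
— the general-`p` analogue of route 2's `p = 3` END of record
`ClassX4M.bsdp_three_rankZero_of_surj_of_katoHalf_of_firstUnitIndex_of_pow_le_card_selmerGroup`
(`Additive/BudgetFromSelmerGroup.lean:111`; r2 GEN 43 2026-08-22T08:25Z (3): the 10 (M) rows @ ≥ 5 of
the `13 W ≥ 1` are served by p07's `…_of_firstUnitIndex_of_budget`, and the Ш-door
`budgetLeLambdaAt_of_prop414_of_pow_le_card_selmerGroup` is general-`p`): displayed named facts
{hK, hDelX, hGZK, hmod, hmodD, h414} = 6 (p07's 7 minus {hDel, hPal}, plus the door's h414 — exactly as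
at `p = 3`); `hPal` is fed by its tree proof (load-bearing at `p ≡ 1 (mod 4)`: a proved-away fact, not
an idle one). PER PAIR; nothing booked. [cite: GreenbergLNM1716, Prop. 4.14 (p. 114)]
[cite: Kato2004Asterisque, Thm. 17.4 (3) (p. 273)] [cite: Delbourgo1998, Prop. 4 (p. 144) and §2.2 Lemma (ii) (p. 139)]
[cite: Pal2012, Thm. 3.2] [cite: Miller2011LMS, §1 and Def. 1.1] -/
theorem ClassX4M.bsdp_rankZero_of_surj_of_katoHalf_of_firstUnitIndex_of_pow_le_card_selmerGroup_exact
    (hK : Wuthrich2014.kato_halfEigenCharIdeal_dvd_cyclotomicPrime_of_surjective)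
    (hDelX : Delbourgo1998.prop4_rankZero_constantCoeff_eq_unit_mul_of_potMult)
    (hGZK : rank_eq_analyticRank_of_analyticRank_le_one) (hmod : hasEntireLFunction_rat)
    (hmodD : nonempty_modularParametrizationData)
    (h414 : Greenberg1999.prop414_noFiniteSubmodule_of_not_dvd_torsionOrder)
    (hX : ClassX4M W p) (hsurj : Surj W p) (hr : W.analyticRank = 0) {b : ℕ}
    (hrec : (p % 4 = 1 → MultFirstUnitIndexAt W p b) ∧ (p % 4 = 3 → MultOddFirstUnitIndexAt W p b))
    (hSel : p ^ b ≤ Nat.card (selmerGroup W (p : ℤ))) : BSDp W p :=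
  hX.bsdp_rankZero_of_surj_of_katoHalf_of_firstUnitIndex_of_budget_exact hK hDelX hGZK hmod hmodD hsurj hr
    hrec (budgetLeLambdaAt_of_prop414_of_pow_le_card_selmerGroup h414 (not_dvd_torsionOrder_of_surj p W hsurj)
      hSel)

end Summit.BirchSwinnertonDyer.Rank1Residual.AdditivePotMult

end
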